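import Summits.QuantumFields.YangMills.Theorems.UnitScaleTiltProp7TentQuasiInterpolantRep
import Summits.QuantumFields.YangMills.Theorems.UnitScaleTiltProp7TentFrameRowsOfRegPr
import Summits.QuantumFields.YangMills.Theorems.UnitScaleTiltProp7HcoOfDivRecovery
import HarnessLib

/-!
# Route `UnitScaleTilt`, crux K1 «MinimiserStabilityRegPr» (stmt-QuantumFields-19200) — route-R E′ (A′), LANE II «DIVERGENCE RECOVERY AT CURVED `W`» (★★OWNER RULING №23),
# brick (B2a), sub-pen F4 (★p1 g19 NAMER WORD №6 (3)), FILE F4-B4 = SIGNATURE-0 (B2a-F4): **THE COVARIANT TENT QUASI-INTERPOLANT `I_σ` OF `QprimeCombL2 W` ON `RegPr` AND ITS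
# POINTWISE, GRADIENT, REPRODUCTION AND SIZE ROWS** — the `I_σ` of ★p1 g19's `J := I_σ + J⁰_σ∘N∘(1 − Q′I_σ)` (SIGNATURE-0 (B2a) a47f22982299de03)

Cell `ym3-torus` ∕ width seat `ym3-torus-px3` (gen 6).  THEOREMS ONLY (0 `def`, 0 `sorry`); `--supports stmt-QuantumFields-19200 --as helper`, count-neutral.  YM₃ on T³ is a ladder rung (R3),
not d = 4, not infinite volume, not the Clay problem; nothing here claims [Balaban1985BackgroundPropagators] Thm 3.11, `hN06`, (REC), E′, EX or the gap.

ASSEMBLY ONLY: ✓`Prop7TentQuasiInterpolantCore.exists_tentQuasiInterpolant_core` (construction, POINTWISE, averaging identity) ∘ ✓`norm_sq_toL2S_tent_le` (SIZE, `CS = 16`) ∘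
✓`Prop7TentQuasiInterpolantGrad.norm_sq_DL2_tent_le` (GRADIENT, `CI = 4608`) ∘ ✓`Prop7TentQuasiInterpolantRep.sum_norm_sq_sub_avg_tent_le` (REPRODUCTION, `CR = 384`) ∘ px15 g5's
✓`Prop7TentFrameRowsOfRegPr` member frame rows at `RegPr` ((M-THIN) `θ₁ = 12ε`, (M-FAT) `θ₂ = (36 + 3CT)ε`, (M-REP) `θ₃ = 14616ε` inside the L-only radius `e₃(L)` of px5 g6's
✓`Prop7CombVsAxialTransport.norm_compT_bgT_sub_axialFn_le`).  `CI′ = 48·(128(36+3CT)² + 1152)`, `CR′ = 512·(14652 + 3CT)²`, `eI := e₃(L)`; every constant L-free but `eI`, bound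
BEFORE `F n K e W T`.

References: T. Bałaban, CMP **99** (1985) 389–434 [Balaban1985BackgroundPropagators] ((3.3) p.391, (3.11) p.392, (3.17)–(3.19) p.393); CMP **98** (1985) 17–51 [Balaban1985Averaging] ((52)–(53) p.27,
pp.24–25); CMP **99** (1985) 75–102 [Balaban1985RegularSpaces] ((1.3), (1.7) p.77, Lemma 1 p.79, (1.70) p.88).
-/

set_option autoImplicit false

noncomputable section

open scoped InnerProductSpace ComplexConjugate Matrix.Norms.L2Operator BigOperators

namespace Summit.QuantumFields.YangMills.Theorems.Prop7TentQuasiInterpolant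

open Literature.MathematicalPhysics.QuantumFieldTheory.Balaban1983to89
open Literature.MathematicalPhysics.QuantumFieldTheory.Balaban1983to89.T3ContinuumYM3Torus
open Literature.MathematicalPhysics.QuantumFieldTheory.Balaban1983to89.T3PrintedRegularMinimiser (RegPr)
open Literature.MathematicalPhysics.QuantumLattice (blockMap blockBase)
open B7Prop1Explicit renaming Site → LSite
open B7Prop1Explicit (U1 axialFn e)
open B7Eq78Linearization (conjR)
open B8Eq119TwistedAxial (bgT)
open B9B8AveragingKernelZd (blockIter compT)
open B10Eq27TorusAxialLog (transl pull holT unitsField toUField)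
open T4TermwiseTorus (tlift tcls)
open T3SectALandauChart (bgUnits eta pos_of_regPr)
open B11Eq103H1Complex (SiteL2K BondL2K)
open Summit.QuantumFields.YangMills.Theorems.Prop7SectET3Transport (periodsT3)
open Summit.QuantumFields.YangMills.Theorems.Prop7SectET3HilbertLetters (W₂ toL2S DL2)
open Summit.QuantumFields.YangMills.Theorems.Prop7SPrint (basePt)
open Summit.QuantumFields.YangMills.Theorems.Prop7QprimeCombL2 (QprimeCombL2)
open Summit.QuantumFields.YangMills.Theorems.Prop7TentQuasiInterpolantCore (exists_tentQuasiInterpolant_core norm_sq_toL2S_tent_le)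
open Summit.QuantumFields.YangMills.Theorems.Prop7TentQuasiInterpolantGrad (norm_sq_DL2_tent_le)
open Summit.QuantumFields.YangMills.Theorems.Prop7TentQuasiInterpolantRep (sum_norm_sq_sub_avg_tent_le)
open Summit.QuantumFields.YangMills.Theorems.Prop7TentFrameRowsOfRegPr (tentFrame_thin_of_regPr tentFrame_fat_of_regPr tentFrame_rep_of_regPr)

variable (c₀ : ℕ → ℝ) [hc₀ : ∀ L : ℕ, Fact (0 < c₀ L)]

/-- ★★★ **(B2a-F4) THE COVARIANT TENT QUASI-INTERPOLANT `I_σ` OF `QprimeCombL2 W` ON `RegPr` AND ITS FOUR ROWS.**  Letters = ★p1 g19's frozen frame letters (NAMER WORD №6 (2)):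
`W♯ := pull (bgUnits F K W) (basePt F n K)`, `k := K − n`, `ℓ := L^k`, `Y z := (blockMap L)^[k] z`, one-shot axial frames `σ_{Y'}(z) := axialFn W♯ (blockBase ℓ Y') z` from the CORNER of box `Y'`
(★p1's `σ_W z` is `σ_{Y z}(z)`); coarse transporter `T` with the (B3c) closeness rider of SIGNATURE-0 (B2a) VERBATIM.
THE INTERPOLANT (POINTWISE row): `toL2S⁻¹(I w)(transl x₀ z) = Σ_{δ : Fin 3 → Fin 2} Θ(Y z − δ, z) • Ad(σ_{Y z − δ}(z))⁻¹ w(tcls N_k (Y z − δ))` with the tensor TENT p.o.u. at spacing `ℓ`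
anchored in the positive orthant of the corners, `Θ(Y', z) := Π_i max 0 (1 − |z_i − ℓY'_i − ℓ|∕ℓ)` (`Σ_δ Θ = 1`, slopes `ℓ⁻¹`, eight boxes per site, every root `ℓY' ≤ z` with `|z − ℓY'|_∞ < 2ℓ`).
ROWS (skeleton currencies `‖w‖♮² = c₀ℓ³Σ_y‖w y‖²`, `‖D̄_T w‖♮² = c₀ℓ³Σ_c‖Ad(T c) w(c₊) − w(c₋)‖²`): (GRADIENT) `‖DL2 W (I w)‖² ≤ CI·‖D̄_T w‖♮² + CI′·e²·‖w‖♮²`; (REPRODUCTION)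
`‖w − Q′_W(I w)‖♮² ≤ CR·‖D̄_T w‖♮² + CR′·e²·‖w‖♮²`; (SIZE) `‖I w‖² ≤ CS·‖w‖♮²`; constants bound BEFORE `F n K e W T` (L-free but the radius `eI`).
[cite: Balaban1985BackgroundPropagators, (3.17)-(3.19) p.393, (3.3) p.391, (3.11) p.392; Balaban1985Averaging, (52)-(53) p.27, pp.24-25; Balaban1985RegularSpaces, (1.7) p.77, (1.70) p.88] -/
theorem exists_tentQuasiInterpolant :
    ∀ (L : ℕ), 1 < L → ∀ (CT : ℝ), 0 ≤ CT → ∃ CI CI' CR CR' CS eI : ℝ, 0 ≤ CI ∧ 0 ≤ CI' ∧ 0 ≤ CR ∧ 0 ≤ CR' ∧ 0 ≤ CS ∧ 0 < eI ∧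
      ∀ (F : T3Family), F.L = L → ∀ (n K : ℕ) (hnK : n < K) (e : ℝ), 0 ≤ e → e ≤ eI →
        ∀ (W : GaugeField (F.P K) 0 (Matrix.specialUnitaryGroup (Fin 2) ℂ)), RegPr F n K e W →
        ∀ (T : PBond (F.P K) (K - n) → (Matrix (Fin 2) (Fin 2) ℂ)ˣ), (∀ c, T c ∈ U1 (Matrix (Fin 2) (Fin 2) ℂ)) →
          (∀ c : PBond (F.P K) (K - n),
            ‖(T c : Matrix (Fin 2) (Fin 2) ℂ) - ((holT (unitsField (toUField W)) (transl (basePt F n K) (blockBase ((F.P K).L ^ (K - n)) (tlift c.src)))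
                (List.replicate ((F.P K).L ^ (K - n)) (c.dir, true)) : (Matrix (Fin 2) (Fin 2) ℂ)ˣ) : Matrix (Fin 2) (Fin 2) ℂ)‖ ≤ CT * e) →
        ∃ I : (Site (F.P K) (K - n) → Matrix (Fin 2) (Fin 2) ℂ) →ₗ[ℂ] SiteL2K ℂ 3 (periodsT3 F K) (c₀ F.L) W₂,
          (∀ (w : Site (F.P K) (K - n) → Matrix (Fin 2) (Fin 2) ℂ) (z : LSite (F.P K).d),
            (toL2S F K (c₀ F.L)).symm (I w) (transl (basePt F n K) z)
              = ∑ δ : Fin (F.P K).d → Fin 2,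
                  (∏ i : Fin (F.P K).d, max 0 (1 - |((z i - ((F.P K).L ^ (K - n) : ℕ) * (((blockMap (F.P K).L)^[K - n] z - fun i => ((δ i : ℕ) : ℤ)) i) : ℤ) : ℝ)
                      - (((F.P K).L ^ (K - n) : ℕ) : ℝ)| / (((F.P K).L ^ (K - n) : ℕ) : ℝ))) •
                    conjR (axialFn (pull (bgUnits F K W) (basePt F n K)) (blockBase ((F.P K).L ^ (K - n)) ((blockMap (F.P K).L)^[K - n] z - fun i => ((δ i : ℕ) : ℤ))) z)⁻¹
                      (w (tcls ((F.P K).sitesPerDir (K - n)) ((blockMap (F.P K).L)^[K - n] z - fun i => ((δ i : ℕ) : ℤ))))) ∧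
          (∀ w, ‖DL2 F n K (c₀ F.L) W (I w)‖ ^ 2
              ≤ CI * (c₀ F.L * ((F.L : ℝ) ^ (K - n)) ^ 3 * ∑ c : PBond (F.P K) (K - n), ‖conjR (T c) (w (c.src.shift c.dir)) - w c.src‖ ^ 2)
                + CI' * e ^ 2 * (c₀ F.L * ((F.L : ℝ) ^ (K - n)) ^ 3 * ∑ y : Site (F.P K) (K - n), ‖w y‖ ^ 2)) ∧
          (∀ w, c₀ F.L * ((F.L : ℝ) ^ (K - n)) ^ 3 * ∑ y : Site (F.P K) (K - n), ‖w y - QprimeCombL2 F n K (c₀ F.L) W (I w) y‖ ^ 2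
              ≤ CR * (c₀ F.L * ((F.L : ℝ) ^ (K - n)) ^ 3 * ∑ c : PBond (F.P K) (K - n), ‖conjR (T c) (w (c.src.shift c.dir)) - w c.src‖ ^ 2)
                + CR' * e ^ 2 * (c₀ F.L * ((F.L : ℝ) ^ (K - n)) ^ 3 * ∑ y : Site (F.P K) (K - n), ‖w y‖ ^ 2)) ∧
          (∀ w, ‖I w‖ ^ 2 ≤ CS * (c₀ F.L * ((F.L : ℝ) ^ (K - n)) ^ 3 * ∑ y : Site (F.P K) (K - n), ‖w y‖ ^ 2)) := by
  intro L hL CT hCT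
  obtain ⟨e₃, he₃, hrep⟩ := tentFrame_rep_of_regPr L hL
  refine ⟨4608, 48 * (128 * (36 + 3 * CT) ^ 2 + 8 * 12 ^ 2), 384, 512 * ((36 + 3 * CT) + (87 * 3 * (3 + 1) * (3 + 4)) * 2) ^ 2, 16, e₃,
    by norm_num, by positivity, by norm_num, by positivity, by norm_num, he₃, ?_⟩
  intro F hF n K hnK e he0 heI W hW T hT hclose
  have he : 0 < e := pos_of_regPr F hW
  have hc : 0 < c₀ F.L := (hc₀ F.L).out
  obtain ⟨I, hpt, havg⟩ := exists_tentQuasiInterpolant_core F n K (c₀ F.L) hnK.le W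
  -- the member frame rows (px15 g5)
  have hthin := fun (z : LSite (F.P K).d) (μ : Fin (F.P K).d) (δ : Fin (F.P K).d → Fin 2) => tentFrame_thin_of_regPr F n K hW z μ δ
  have hfat := fun (z : LSite (F.P K).d) (δ : Fin (F.P K).d → Fin 2) => tentFrame_fat_of_regPr F n K hW hnK.le hCT T hT hclose z δ
  have hrepF := hrep F hF n K hnK.le e W he heI hW
  refine ⟨I, hpt, fun w => ?_, fun w => ?_, fun w => ?_⟩
  · -- GRADIENT
    have hI : I w = toL2S F K (c₀ F.L) ((toL2S F K (c₀ F.L)).symm (I w)) := (LinearEquiv.apply_symm_apply _ _).symm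
    rw [hI]
    have h := norm_sq_DL2_tent_le F n K (c₀ F.L) hnK.le W T hT (θ₁ := 12 * e) (θ₂ := (36 + 3 * CT) * e)
      (fun z μ δ => by have h1 := hthin z μ δ; rw [show 12 * e * eta F n K = 12 * e * eta F n K from rfl] at h1; exact h1)
      hfat w ((toL2S F K (c₀ F.L)).symm (I w)) (hpt w)
    refine h.trans (le_of_eq ?_)
    ring
  · -- REPRODUCTION
    have hq : ∀ y : Site (F.P K) (K - n), QprimeCombL2 F n K (c₀ F.L) W (I w) y
        = ∑ x ∈ blockIter (F.P K).L (K - n) (tlift y),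
            ((((F.P K).L : ℝ) ^ (F.P K).d)⁻¹) ^ (K - n) •
              conjR (compT (F.P K).L (bgT (F.P K).L (pull (bgUnits F K W) (basePt F n K))) (K - n) (tlift y) x)
                (∑ δ : Fin (F.P K).d → Fin 2,
                  (∏ i : Fin (F.P K).d, max 0 (1 - |((x i - ((F.P K).L ^ (K - n) : ℕ) * (((blockMap (F.P K).L)^[K - n] x - fun i => ((δ i : ℕ) : ℤ)) i) : ℤ) : ℝ)
                      - (((F.P K).L ^ (K - n) : ℕ) : ℝ)| / (((F.P K).L ^ (K - n) : ℕ) : ℝ))) •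
                    conjR (axialFn (pull (bgUnits F K W) (basePt F n K)) (blockBase ((F.P K).L ^ (K - n)) ((blockMap (F.P K).L)^[K - n] x - fun i => ((δ i : ℕ) : ℤ))) x)⁻¹
                      (w (tcls ((F.P K).sitesPerDir (K - n)) ((blockMap (F.P K).L)^[K - n] x - fun i => ((δ i : ℕ) : ℤ))))) := by
      intro y
      rw [havg w y]
      exact Finset.sum_congr rfl fun x _ => by rw [hpt w x]
    have hθ : 0 ≤ (36 + 3 * CT) * e + 87 * 3 * (3 + 1) * (3 + 4) * (2 * e) := by positivity
    have h := sum_norm_sq_sub_avg_tent_le F n K W T hT hθ hfat (fun Y z hz => (hrepF Y z hz).1) (fun Y z hz => (hrepF Y z hz).2)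
      w (fun y => QprimeCombL2 F n K (c₀ F.L) W (I w) y) hq
    have hpos : 0 ≤ c₀ F.L * ((F.L : ℝ) ^ (K - n)) ^ 3 := by positivity
    calc c₀ F.L * ((F.L : ℝ) ^ (K - n)) ^ 3 * ∑ y : Site (F.P K) (K - n), ‖w y - QprimeCombL2 F n K (c₀ F.L) W (I w) y‖ ^ 2
        ≤ c₀ F.L * ((F.L : ℝ) ^ (K - n)) ^ 3 * (384 * ∑ c : PBond (F.P K) (K - n), ‖conjR (T c) (w (c.src.shift c.dir)) - w c.src‖ ^ 2
            + 512 * ((36 + 3 * CT) * e + 87 * 3 * (3 + 1) * (3 + 4) * (2 * e)) ^ 2 * ∑ y : Site (F.P K) (K - n), ‖w y‖ ^ 2) :=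
          mul_le_mul_of_nonneg_left h hpos
      _ = _ := by ring
  · -- SIZE
    have hI : I w = toL2S F K (c₀ F.L) ((toL2S F K (c₀ F.L)).symm (I w)) := (LinearEquiv.apply_symm_apply _ _).symm
    rw [hI]
    exact norm_sq_toL2S_tent_le hnK.le W w ((toL2S F K (c₀ F.L)).symm (I w)) (hpt w)

end Summit.QuantumFields.YangMills.Theorems.Prop7TentQuasiInterpolant

end
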